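import Summits.Ventures.HodgeRepro.BallCongruence

/-!
# The finite-index clause of Lemma W for `U(2,1)(K)`, `K ⊂ ℂ` a number field (seat p5)

Blind re-derivation cell `pub-hodge-repro`, seat `p5`.  Built on `BallCongruence.lean`; Mathlib otherwise.

`BallCongruence.isFiniteRelIndex_inf_conjSub` asks for a ring `R`, an injective `φ : R →+* ℂ`, a Hecke
element `g` with `N · g`, `N · g⁻¹` integral and `R/(N² M)` finite.  Here these hypotheses are discharged
in the arithmetic situation of ROUTE.md A4 (`G(ℚ)` acting on the ball through `U(2,1)(K)`):

* `isFiniteRelIndex_inf_conjSub_of_hasFiniteQuotients` — over any domain `R` with finite quotients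
  (`Ring.HasFiniteQuotients`), the finiteness hypothesis is just `N ≠ 0`, `M ≠ 0`;
* `IsKRational σ g` — `g ∈ U(2,1)(K)`: matrix and inverse matrix with entries in `σ(K)`;
* `exists_denominator` — **common denominator**: a `K`-rational `g` has `N · g`, `N · g⁻¹` integral over
  `𝓞_K` for some `N ∈ 𝓞_K ∖ {0}` (`IsLocalization.exist_integer_multiples_of_finite`);
* `isFiniteRelIndex_inf_conjSub_gaussianInt` — the Picard modular lattice `U(2,1; ℤ[i])` (`Module.Finite ℤ ℤ[i]`
  from the surjection `ℤ × ℤ → ℤ[i]`);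
* `isFiniteRelIndex_inf_conjSub_numberField` — **the clause as A4 states it**: for a number field
  `σ : K ↪ ℂ`, `Γ(M) ≤ Γ′ ≤ U(2,1)(𝓞_K)` with `M ≠ 0`, and every `g ∈ U(2,1)(K)`, the subgroup
  `Γ′ ⊓ g⁻¹ Γ′ g` has finite index in `Γ′`; `isInvariantTop_wedgeForm_pull_numberField` adds the
  invariance of `(g^*F) ∧ G` under it.

Nothing here says anything about the status of the Hodge conjecture for CM abelian varieties.
-/

set_option autoImplicit false

noncomputable section

universe u

namespace Summit.Ventures.HodgeRepro

namespace BallCong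

open Matrix hiding J
open BallModel BallCore BallInv

/-! ### Domains with finite quotients -/

section hasFiniteQuotients

variable {R : Type u} [CommRing R] [IsDomain R] [Ring.HasFiniteQuotients R] (φ : R →+* ℂ)
  (hφ : Function.Injective φ)

omit [IsDomain R] in
/-- In a ring with finite quotients, `R/(k)` is finite for `k ≠ 0`. -/
theorem finite_quotient_span_of_ne_zero {k : R} (hk : k ≠ 0) : Finite (R ⧸ Ideal.span {k}) :=
  Ring.HasFiniteQuotients.finiteQuotient (by rwa [Ne, Ideal.span_singleton_eq_bot])

/-- The finite-index clause over a domain with finite quotients: the finiteness hypothesis becomes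
`N ≠ 0`, `M ≠ 0`. -/
theorem isFiniteRelIndex_inf_conjSub_of_hasFiniteQuotients {Γ' : Subgroup U21} (hΓ : Γ' ≤ arith φ)
    {M : R} (hM0 : M ≠ 0) (hM : congr φ hφ M ≤ Γ') (g : U21) {N : R} (hN : N ≠ 0)
    (A B : Matrix (Fin 3) (Fin 3) R) (hA : Mφ φ A = φ N • mat g) (hB : Mφ φ B = φ N • mat g⁻¹) :
    (Γ' ⊓ conjSub g Γ').IsFiniteRelIndex Γ' := by
  haveI : Finite (R ⧸ Ideal.span {N ^ 2 * M}) :=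
    finite_quotient_span_of_ne_zero (mul_ne_zero (pow_ne_zero 2 hN) hM0)
  exact isFiniteRelIndex_inf_conjSub φ hφ hΓ hM g A B hA hB

end hasFiniteQuotients

/-! ### Number fields: `U(2,1)(K)` and common denominators -/

section numberField

open NumberField

variable (K : Type u) [Field K] [NumberField K] (σ : K →+* ℂ)

/-- The embedding `𝓞_K → ℂ` induced by `σ : K → ℂ`. -/
def φ𝓞 : 𝓞 K →+* ℂ := σ.comp (algebraMap (𝓞 K) K)

omit [NumberField K] in
/-- `φ𝓞` is injective. -/
theorem φ𝓞_injective : Function.Injective (φ𝓞 K σ) :=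
  σ.injective.comp RingOfIntegers.coe_injective

omit [NumberField K] in
/-- `φ𝓞` unfolded. -/
theorem φ𝓞_apply (x : 𝓞 K) : φ𝓞 K σ x = σ (algebraMap (𝓞 K) K x) := rfl

/-- `𝓞_K` has finite quotients (a domain, finitely generated over `ℤ`). -/
instance hasFiniteQuotients_ringOfIntegers : Ring.HasFiniteQuotients (𝓞 K) := by
  haveI : Module.Finite ℤ (𝓞 K) := Module.Finite.iff_addGroup_fg.mpr inferInstance
  infer_instance

/-- `g ∈ U(2,1)(K)`: the matrix and the inverse matrix of `g` have entries in `σ(K)`. -/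
def IsKRational (g : U21) : Prop :=
  (∃ A : Matrix (Fin 3) (Fin 3) K, σ.mapMatrix A = mat g) ∧
    ∃ B : Matrix (Fin 3) (Fin 3) K, σ.mapMatrix B = mat g⁻¹

/-- A matrix over `K` whose `σ`-image is `X` times a common denominator: the integral multiple. -/
theorem exists_integral_multiple_of_finite {ι : Type} [Finite ι] (f : ι → K) :
    ∃ N : 𝓞 K, N ≠ 0 ∧ ∃ r : ι → 𝓞 K, ∀ i, algebraMap (𝓞 K) K (r i) = (N : K) * f i := by
  obtain ⟨b, hb⟩ := IsLocalization.exist_integer_multiples_of_finite (nonZeroDivisors (𝓞 K)) f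
  choose r hr using fun i => RingHom.mem_rangeS.mp (hb i)
  refine ⟨b, nonZeroDivisors.ne_zero b.2, r, fun i => ?_⟩
  rw [hr i, Algebra.smul_def]

/-- **Common denominator.**  A `K`-rational `g ∈ U(2,1)` has `N · g` and `N · g⁻¹` integral over
`𝓞_K` for some `N ∈ 𝓞_K ∖ {0}`. -/
theorem exists_denominator {g : U21} (hg : IsKRational K σ g) :
    ∃ N : 𝓞 K, N ≠ 0 ∧ ∃ A B : Matrix (Fin 3) (Fin 3) (𝓞 K),
      Mφ (φ𝓞 K σ) A = φ𝓞 K σ N • mat g ∧ Mφ (φ𝓞 K σ) B = φ𝓞 K σ N • mat g⁻¹ := by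
  obtain ⟨⟨A, hA⟩, ⟨B, hB⟩⟩ := hg
  obtain ⟨N, hN, r, hr⟩ := exists_integral_multiple_of_finite K
    (Sum.elim (fun p : Fin 3 × Fin 3 => A p.1 p.2) fun p : Fin 3 × Fin 3 => B p.1 p.2)
  refine ⟨N, hN, Matrix.of fun i j => r (Sum.inl (i, j)), Matrix.of fun i j => r (Sum.inr (i, j)),
    ?_, ?_⟩
  · ext i j
    rw [← hA]
    simp only [RingHom.mapMatrix_apply, Matrix.map_apply, Matrix.of_apply, Matrix.smul_apply,
      smul_eq_mul, φ𝓞_apply, hr, Sum.elim_inl, map_mul]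
  · ext i j
    rw [← hB]
    simp only [RingHom.mapMatrix_apply, Matrix.map_apply, Matrix.of_apply, Matrix.smul_apply,
      smul_eq_mul, φ𝓞_apply, hr, Sum.elim_inr, map_mul]

/-- **The finite-index clause of Lemma W (ROUTE.md A4) for `U(2,1)(K)`.**  For a number field
`σ : K ↪ ℂ`, `Γ(M) ≤ Γ′ ≤ U(2,1)(𝓞_K)` with `M ≠ 0`, and every `g ∈ U(2,1)(K)`, the subgroup
`Γ′ ⊓ g⁻¹ Γ′ g` has finite index in `Γ′`. -/
theorem isFiniteRelIndex_inf_conjSub_numberField {Γ' : Subgroup U21} (hΓ : Γ' ≤ arith (φ𝓞 K σ))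
    {M : 𝓞 K} (hM0 : M ≠ 0) (hM : congr (φ𝓞 K σ) (φ𝓞_injective K σ) M ≤ Γ') {g : U21}
    (hg : IsKRational K σ g) : (Γ' ⊓ conjSub g Γ').IsFiniteRelIndex Γ' := by
  obtain ⟨N, hN, A, B, hA, hB⟩ := exists_denominator K σ hg
  exact isFiniteRelIndex_inf_conjSub_of_hasFiniteQuotients (φ𝓞 K σ) (φ𝓞_injective K σ) hΓ hM0 hM g
    hN A B hA hB

/-- **A4, both clauses, for `U(2,1)(K)`.**  For `Γ′`-invariant fields `F, G` and `g ∈ U(2,1)(K)`, the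
`(2,0)`-form `(g^*F) ∧ G` is invariant under `Γ′ ⊓ g⁻¹ Γ′ g`, a subgroup of finite index in `Γ′`. -/
theorem isInvariantTop_wedgeForm_pull_numberField {Γ' : Subgroup U21} (hΓ : Γ' ≤ arith (φ𝓞 K σ))
    {M : 𝓞 K} (hM0 : M ≠ 0) (hM : congr (φ𝓞 K σ) (φ𝓞_injective K σ) M ≤ Γ') {g : U21}
    (hg : IsKRational K σ g) {F G : Ball → Fin 2 → ℂ} (hF : IsInvariant Γ' F)
    (hG : IsInvariant Γ' G) :
    IsInvariantTop (Γ' ⊓ conjSub g Γ') (wedgeForm (pull g F) G) ∧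
      (Γ' ⊓ conjSub g Γ').IsFiniteRelIndex Γ' :=
  ⟨isInvariantTop_wedgeForm_pull hF hG g, isFiniteRelIndex_inf_conjSub_numberField K σ hΓ hM0 hM hg⟩

end numberField

/-! ### The Picard modular lattice `U(2,1; ℤ[i])` -/

section gaussianInt

/-- `(a, b) ↦ a + b i`, a `ℤ`-linear map `ℤ × ℤ → ℤ[i]`. -/
def ofPair : ℤ × ℤ →ₗ[ℤ] GaussianInt where
  toFun q := ⟨q.1, q.2⟩
  map_add' q r := by ext <;> simp
  map_smul' n q := by ext <;> simp [zsmul_eq_mul, Zsqrtd.smul_val]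

/-- `ofPair` is surjective. -/
theorem ofPair_surjective : Function.Surjective ofPair := fun z => ⟨(z.re, z.im), rfl⟩

/-- `ℤ[i]` is a finitely generated `ℤ`-module. -/
instance instModuleFiniteGaussianInt : Module.Finite ℤ GaussianInt :=
  Module.Finite.of_surjective ofPair ofPair_surjective

/-- `ℤ[i]` has finite quotients. -/
instance hasFiniteQuotients_gaussianInt : Ring.HasFiniteQuotients GaussianInt := inferInstance

/-- **The finite-index clause for the Picard modular lattice `U(2,1; ℤ[i])`** (the lattice of ROUTE.md
§3.2): `Γ(M) ≤ Γ′ ≤ U(2,1)(ℤ[i])`, `M ≠ 0`, and `g ∈ U(2,1)` with `N · g`, `N · g⁻¹` Gaussian-integral,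
`N ≠ 0` ⇒ `Γ′ ⊓ g⁻¹ Γ′ g` has finite index in `Γ′`. -/
theorem isFiniteRelIndex_inf_conjSub_gaussianInt {Γ' : Subgroup U21}
    (hΓ : Γ' ≤ arith GaussianInt.toComplex) {M : GaussianInt} (hM0 : M ≠ 0)
    (hM : congr GaussianInt.toComplex GaussianInt.toComplex_injective M ≤ Γ') (g : U21)
    {N : GaussianInt} (hN : N ≠ 0) (A B : Matrix (Fin 3) (Fin 3) GaussianInt)
    (hA : Mφ GaussianInt.toComplex A = GaussianInt.toComplex N • mat g)
    (hB : Mφ GaussianInt.toComplex B = GaussianInt.toComplex N • mat g⁻¹) :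
    (Γ' ⊓ conjSub g Γ').IsFiniteRelIndex Γ' :=
  isFiniteRelIndex_inf_conjSub_of_hasFiniteQuotients _ GaussianInt.toComplex_injective hΓ hM0 hM g hN
    A B hA hB

end gaussianInt

end BallCong

end Summit.Ventures.HodgeRepro

end
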